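import Literature.NumberTheory.EllipticCurves.Curve8x121IsogenyRank
import Literature.NumberTheory.EllipticCurves.Curve8x121SelmerPointClasses
import HarnessLib

/-!
# A finite, non-trivial `2`-primary Tate–Shafarevich group AT RANK `1`: `X : y² = x³ + 8x² + 121x` has
# `rank X(ℚ) = 1`, `t_2(X) = 0` and `#Ш(X/ℚ)[φ] = 4` (descent via `2`-isogeny inside the isogeny class; Silverman, AEC X.4.9, X.6.5)

Topic `NumberTheory/EllipticCurves`. Third of three files (`Curve8x121RankDescent`: rank `1` and `t_2(X) = 0` through the sharp
descent on the isogenous `Y : y² = x(x − 14)(x − 44)`; `Curve8x121SelmerAll`: `9` everywhere-locally-soluble classes of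
`S(-16, -420)` by explicit local points). Here:

* §1 the `8` classes of `S(-16, -420)` that come from rational points of `X' = [0, -16, 0, -420, 0]` (integral points
  of the quartics `w² = d u⁴ + -16 u²z² + (-420/d) z⁴`), so `#S ≥ 17 > 16` and **`dim₂ S(-16, -420) = 5`**:
  all `32` classes are everywhere locally soluble;
* §2 `#ᾱ(X'(ℚ)) = 8` (`≥` by the points, `≤` by `#α(X(ℚ))·#ᾱ(X'(ℚ)) = 2^{rank + 2} = 8`), hence Silverman's count
  `2^{dim₂ S^{(φ)}(X/ℚ)} = #ᾱ(X'(ℚ)) · #(Ш(X/ℚ) ∩ im Ξ)` gives **`#(Ш(X/ℚ) ∩ im Ξ) = 32/8 = 4`**: `Ш(X/ℚ)[φ] ≅ (ℤ/2ℤ)²`;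
* §3 consequences: `Ш(X/ℚ) ≠ 0`, `Ш(X/ℚ)[2] ≠ 0`, `Ш(X/ℚ)[2^∞]` FINITE and NON-ZERO on a curve of rank `1`; `Ш[2]` is not
  an isogeny invariant (`Ш(Y/ℚ)[2] = 0`, `X ~ Y`) while `t_2(X) = t_2(Y) = 0`; `corank_{ℤ₂} Sel_{2^∞}(X/ℚ) = 1 = rank X(ℚ)`.

Everything is re-verified by the kernel. Theorems only; no definitions, no named facts.

## References

* [SilvermanAEC2009] J. H. Silverman, *AEC*, 2nd ed.: Prop. X.4.9, Thm. X.4.2(a), Prop. X.4.7, Prop. X.6.5(b) (the method).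
* [SilvermanTate2015] J. H. Silverman, J. Tate, *Rational Points on Elliptic Curves*, §3.5–§3.6.
* [Greenberg1999LNM] R. Greenberg, LNM 1716, §1 pp. 54–57.
-/

noncomputable section

open scoped Classical

namespace Literature.NumberTheory.EllipticCurves

namespace Curve8x121

open _root_.WeierstrassCurve _root_.WeierstrassCurve.Affine


/-- `b(a² − 4b) ≠ 0` for `(a, b) = (-16, -420)`. [cite: SilvermanAEC2009, Prop. X.4.9] -/
private theorem hab'' : (-420 : ℤ) * ((-16 : ℤ) ^ 2 - 4 * -420) ≠ 0 := by norm_num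

/-- Squarefree integers with the same square class in `ℚ*/ℚ*²` are equal. [cite: SilvermanTate2015, §3.5] -/
private theorem eq_of_sqClass_intCast_eq {d₁ d₂ : ℤ} (h₁ : Squarefree d₁) (h₂ : Squarefree d₂)
    (he : sqClass (d₁ : ℚ) = sqClass (d₂ : ℚ)) : d₁ = d₂ := by
  have h0₁ : (d₁ : ℚ) ≠ 0 := by exact_mod_cast h₁.ne_zero
  have h0₂ : (d₂ : ℚ) ≠ 0 := by exact_mod_cast h₂.ne_zero
  have h1 : sqClass ((d₁ : ℚ) * d₂) = 1 := by rw [sqClass_mul h0₁ h0₂, he, SqUnits.mul_self]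
  obtain ⟨u, hu⟩ := (sqClass_eq_one_iff (mul_ne_zero h0₁ h0₂)).mp h1
  obtain ⟨m, hm⟩ : IsSquare (d₁ * d₂) := by
    rw [← Rat.isSquare_intCast_iff]
    exact ⟨u, by push_cast; rw [hu, pow_two]⟩
  exact eq_of_squarefree_of_mul_eq_sq h₁ h₂ (m := m) (by rw [hm, pow_two])

/-- Squarefreeness of a (small) integer from the factorisation of its absolute value. [cite: SilvermanTate2015, §3.5] -/
private theorem squarefree_int_of_natAbs {d : ℤ} {n : ℕ} (h : d.natAbs = n) (hn : n ≠ 0)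
    (hnd : n.primeFactorsList.Nodup) : Squarefree d :=
  Int.squarefree_natAbs.mp (h ▸ (Nat.squarefree_iff_nodup_primeFactorsList hn).mpr hnd)

/-- `[x t²] = [x]` in `ℚ*/ℚ*²`. [cite: SilvermanTate2015, §3.5] -/
private theorem sqClass_mul_sq' {x t : ℚ} (hx : x ≠ 0) (ht : t ≠ 0) :
    sqClass (x * t ^ 2) = sqClass x := by
  rw [sqClass_mul hx (pow_ne_zero 2 ht), sqClass_sq, mul_one]

/-- A rational solution of `y² = x³ + ax² + bx` is a nonsingular point of `E_{a,b}`. [cite: SilvermanTate2015, §3.5] -/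
private theorem nonsingular_of_eq' {a b x y : ℚ} [(⟨0, a, 0, b, 0⟩ : WeierstrassCurve ℚ).IsElliptic]
    (hy : y ^ 2 = x ^ 3 + a * x ^ 2 + b * x) : (⟨0, a, 0, b, 0⟩ : WeierstrassCurve ℚ).toAffine.Nonsingular x y := by
  refine Affine.equation_iff_nonsingular.mp ?_
  rw [Affine.equation_iff]
  show y ^ 2 + 0 * x * y + 0 * y = x ^ 3 + a * x ^ 2 + b * x + 0
  linear_combination hy

/-- A rational point `(x, y)`, `x ≠ 0`, of `E_{a,b}` puts `[x]` into `α(E_{a,b}(ℚ))`. [cite: SilvermanTate2015, §3.5] -/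
private theorem sqClass_mem_range_of_eq' {a b x y : ℚ} [(⟨0, a, 0, b, 0⟩ : WeierstrassCurve ℚ).IsElliptic]
    (hy : y ^ 2 = x ^ 3 + a * x ^ 2 + b * x) (hx : x ≠ 0) :
    sqClass x ∈ Set.range (⟨0, a, 0, b, 0⟩ : WeierstrassCurve ℚ).xSqClass :=
  ⟨.some x y (nonsingular_of_eq' hy), xSqClass_some_of_ne_zero _ hx⟩

/-! ## 2. `#ᾱ(X'(ℚ)) = 8` and `#(Ш(X/ℚ) ∩ im Ξ) = 4` -/

/-- **`#α ≥ 8`** on `[0, -16, 0, -420, 0]`: `[1]`, `ᾱ(T') = [-420] = [-105]`, `ᾱ((-3), (-33)) = [-3]`, `ᾱ((-10), (-40)) = [-10]` and products. [cite: SilvermanTate2015, §3.5–§3.6] -/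
theorem card_range_xSqClass_X'_ge :
    (Set.range (⟨0, -16, 0, -420, 0⟩ : WeierstrassCurve ℚ).xSqClass).Finite ∧
      8 ≤ Nat.card (Set.range (⟨0, -16, 0, -420, 0⟩ : WeierstrassCurve ℚ).xSqClass) := by
  haveI := isElliptic_X'
  set W := (⟨0, -16, 0, -420, 0⟩ : WeierstrassCurve ℚ) with hW
  have hfin : (Set.range W.xSqClass).Finite := by
    have h := (natCard_range_xSqClass_le (a := -16) (b := -420) hab'').1
    have e : (⟨0, ((-16 : ℤ) : ℚ), 0, ((-420 : ℤ) : ℚ), 0⟩ : WeierstrassCurve ℚ) = W := by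
      rw [hW]; ext <;> push_cast <;> ring
    rw [e] at h
    exact h
  refine ⟨hfin, ?_⟩
  have hs1 : sqClass (((1 : ℤ)) : ℚ) ∈ Set.range W.xSqClass := by
    refine ⟨0, ?_⟩
    rw [xSqClass_zero, Int.cast_one]
    exact ((sqClass_eq_one_iff one_ne_zero).mpr ⟨1, by norm_num⟩).symm
  have hsm3 : sqClass (((-3 : ℤ)) : ℚ) ∈ Set.range W.xSqClass := by
    have h := sqClass_mem_range_of_eq' (a := -16) (b := -420) (x := (-3)) (y := (-33))
      (by norm_num) (by norm_num)
    rwa [show ((-3) : ℚ) = -3 * (1) ^ 2 by norm_num, sqClass_mul_sq' (by norm_num) (by norm_num),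
      show (-3 : ℚ) = ((-3 : ℤ) : ℚ) by norm_num] at h
  have hsm10 : sqClass (((-10 : ℤ)) : ℚ) ∈ Set.range W.xSqClass := by
    have h := sqClass_mem_range_of_eq' (a := -16) (b := -420) (x := (-10)) (y := (-40))
      (by norm_num) (by norm_num)
    rwa [show ((-10) : ℚ) = -10 * (1) ^ 2 by norm_num, sqClass_mul_sq' (by norm_num) (by norm_num),
      show (-10 : ℚ) = ((-10 : ℤ) : ℚ) by norm_num] at h
  have hsm105 : sqClass (((-105 : ℤ)) : ℚ) ∈ Set.range W.xSqClass := by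
    refine ⟨W.twoTorsionPoint, ?_⟩
    rw [xSqClass_twoTorsionPoint]
    show sqClass (-420 : ℚ) = _
    rw [show (-420 : ℚ) = -105 * 2 ^ 2 by norm_num, sqClass_mul_sq' (by norm_num) (by norm_num)]
    push_cast
    rfl
  have hs30 : sqClass (((30 : ℤ)) : ℚ) ∈ Set.range W.xSqClass := by
    have h := mul_mem_range_xSqClass W hsm3 hsm10
    rwa [← sqClass_mul (by norm_num) (by norm_num), ← Int.cast_mul,
      show ((-3 : ℤ) * -10 : ℤ) = 30 by norm_num] at h
  have hsm14 : sqClass (((-14 : ℤ)) : ℚ) ∈ Set.range W.xSqClass := by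
    have h := mul_mem_range_xSqClass W hsm105 hs30
    rwa [← sqClass_mul (by norm_num) (by norm_num), ← Int.cast_mul,
      show ((-105 : ℤ) * 30 : ℤ) = -14 * 15 ^ 2 by norm_num, Int.cast_mul,
      show (((15 ^ 2 : ℤ)) : ℚ) = (15 : ℚ) ^ 2 by norm_num, sqClass_mul_sq' (by norm_num) (by norm_num)] at h
  have hs35 : sqClass (((35 : ℤ)) : ℚ) ∈ Set.range W.xSqClass := by
    have h := mul_mem_range_xSqClass W hsm105 hsm3
    rwa [← sqClass_mul (by norm_num) (by norm_num), ← Int.cast_mul,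
      show ((-105 : ℤ) * -3 : ℤ) = 35 * 3 ^ 2 by norm_num, Int.cast_mul,
      show (((3 ^ 2 : ℤ)) : ℚ) = (3 : ℚ) ^ 2 by norm_num, sqClass_mul_sq' (by norm_num) (by norm_num)] at h
  have hs42 : sqClass (((42 : ℤ)) : ℚ) ∈ Set.range W.xSqClass := by
    have h := mul_mem_range_xSqClass W hsm105 hsm10
    rwa [← sqClass_mul (by norm_num) (by norm_num), ← Int.cast_mul,
      show ((-105 : ℤ) * -10 : ℤ) = 42 * 5 ^ 2 by norm_num, Int.cast_mul,
      show (((5 ^ 2 : ℤ)) : ℚ) = (5 : ℚ) ^ 2 by norm_num, sqClass_mul_sq' (by norm_num) (by norm_num)] at h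
  have hsqf : ∀ d ∈ ({1, -3, -10, -14, 30, 35, 42, -105} : Finset ℤ), Squarefree d := by
    intro d hd
    simp only [Finset.mem_insert, Finset.mem_singleton] at hd
    rcases hd with rfl | rfl | rfl | rfl | rfl | rfl | rfl | rfl
    · exact squarefree_int_of_natAbs (n := 1) rfl one_ne_zero (by simp)
    · exact squarefree_int_of_natAbs (n := 3) rfl three_ne_zero (by simp)
    · exact squarefree_int_of_natAbs (n := 10) rfl (by norm_num) (by simp)
    · exact squarefree_int_of_natAbs (n := 14) rfl (by norm_num) (by simp)
    · exact squarefree_int_of_natAbs (n := 30) rfl (by norm_num) (by simp)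
    · exact squarefree_int_of_natAbs (n := 35) rfl (by norm_num) (by simp)
    · exact squarefree_int_of_natAbs (n := 42) rfl (by norm_num) (by simp)
    · exact squarefree_int_of_natAbs (n := 105) rfl (by norm_num) (by simp)
  have hsub : (↑(({1, -3, -10, -14, 30, 35, 42, -105} : Finset ℤ).image fun d : ℤ => sqClass (d : ℚ)) :
      Set (SqUnits ℚ)) ⊆ Set.range W.xSqClass := by
    intro c hc
    obtain ⟨d, hd, rfl⟩ := Finset.mem_image.mp (Finset.mem_coe.mp hc)
    simp only [Finset.mem_insert, Finset.mem_singleton] at hd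
    rcases hd with rfl | rfl | rfl | rfl | rfl | rfl | rfl | rfl
    · exact hs1
    · exact hsm3
    · exact hsm10
    · exact hsm14
    · exact hs30
    · exact hs35
    · exact hs42
    · exact hsm105
  have hcard : (({1, -3, -10, -14, 30, 35, 42, -105} : Finset ℤ).image fun d : ℤ => sqClass (d : ℚ)).card = 8 := by
    rw [Finset.card_image_of_injOn (fun d₁ h₁ d₂ h₂ he =>
      eq_of_sqClass_intCast_eq (hsqf d₁ h₁) (hsqf d₂ h₂) he)]
    rfl
  calc 8 = (↑(({1, -3, -10, -14, 30, 35, 42, -105} : Finset ℤ).image fun d : ℤ => sqClass (d : ℚ)) :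
        Set (SqUnits ℚ)).ncard := by rw [Set.ncard_coe_finset, hcard]
    _ ≤ (Set.range W.xSqClass).ncard := Set.ncard_le_ncard hsub hfin
    _ = Nat.card (Set.range W.xSqClass) := (Nat.card_coe_set_eq _).symm

/-- **`#ᾱ(X'(ℚ)) = 8` and `#α(X(ℚ)) = 1`**: `#α(X(ℚ))·#ᾱ(X'(ℚ)) = 2^{rank X(ℚ) + 2} = 8` (Silverman–Tate,
tree `natCard_range_xSqClass_mul`) with `#ᾱ ≥ 8`. [cite: SilvermanTate2015, §3.6 (2^r = #α(Γ)·#ᾱ(Γ̄)/4)] -/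
theorem natCard_range_xSqClass_X'_eq :
    Nat.card (Set.range (⟨0, -16, 0, -420, 0⟩ : WeierstrassCurve ℚ).xSqClass) = 8 ∧
      Nat.card (Set.range (⟨0, 8, 0, 121, 0⟩ : WeierstrassCurve ℚ).xSqClass) = 1 := by
  haveI := isElliptic_X
  have hmul := (⟨0, 8, 0, 121, 0⟩ : WeierstrassCurve ℚ).natCard_range_xSqClass_mul
  rw [twoIsogenyCodomain_X, mordellWeilRank_X] at hmul
  have h4 := card_range_xSqClass_X'_ge.2
  have hfinX : (Set.range (⟨0, 8, 0, 121, 0⟩ : WeierstrassCurve ℚ).xSqClass).Finite := by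
    have h := (natCard_range_xSqClass_le (a := 8) (b := 121) habX).1
    rwa [lit_X] at h
  have h1 : 1 ≤ Nat.card (Set.range (⟨0, 8, 0, 121, 0⟩ : WeierstrassCurve ℚ).xSqClass) := by
    haveI := hfinX.to_subtype
    exact Nat.card_pos (α := Set.range (⟨0, 8, 0, 121, 0⟩ : WeierstrassCurve ℚ).xSqClass)
  set A := Nat.card (Set.range (⟨0, 8, 0, 121, 0⟩ : WeierstrassCurve ℚ).xSqClass) with hA
  set B := Nat.card (Set.range (⟨0, -16, 0, -420, 0⟩ : WeierstrassCurve ℚ).xSqClass) with hB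
  have hmul4 : A * B = 8 := by rw [hmul]; norm_num
  have hBle : B ≤ 8 := by
    calc B = 1 * B := (one_mul B).symm
      _ ≤ A * B := Nat.mul_le_mul_right B h1
      _ = 8 := hmul4
  have hBdvd : B ∣ 8 := Dvd.intro_left A hmul4
  have hB16 : B = 8 := by
    have : B ∈ Nat.divisors 8 := Nat.mem_divisors.mpr ⟨hBdvd, by norm_num⟩
    rw [show Nat.divisors 8 = {1, 2, 4, 8} by decide] at this
    simp only [Finset.mem_insert, Finset.mem_singleton] at this
    omega
  refine ⟨hB16, ?_⟩
  rw [hB16] at hmul4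
  omega

/-- Transport of `#(Ш(X) ∩ im Ξ_X)` along an equality of curve literals. [folklore] -/
private theorem natCard_sha_inf_range_congr {X Y : WeierstrassCurve ℚ}
    [X.IsTwoTorsionNF] [X.IsElliptic] [Y.IsTwoTorsionNF] [Y.IsElliptic] (h : X = Y) :
    Nat.card ↥(X.sha ⊓ X.twoIsogenyTorsorHom.range) = Nat.card ↥(Y.sha ⊓ Y.twoIsogenyTorsorHom.range) := by
  subst h
  rfl

/-- **`#(Ш(X/ℚ) ∩ im Ξ) = 4`: `Ш(X/ℚ)[φ] ≅ (ℤ/2ℤ)²`** for the rank-`1` curve `X = [0, 8, 0, 121, 0]` and its `2`-isogeny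
`φ : X → X'` — `2^{dim₂ S^{(φ)}(X/ℚ)} = #ᾱ(X'(ℚ)) · #Ш(X/ℚ)[φ]` (tree `two_pow_twoIsogenySelmerRank'_eq_natCard_mul`) with
`dim₂ = 5`, `#ᾱ = 8`. [cite: SilvermanAEC2009, Prop. X.6.5(b) (the method) with Thm. X.4.2(a)] -/
theorem natCard_sha_inf_range_eq [hE : (⟨0, 8, 0, 121, 0⟩ : WeierstrassCurve ℚ).IsElliptic] :
    Nat.card ↥((⟨0, 8, 0, 121, 0⟩ : WeierstrassCurve ℚ).sha ⊓
      (⟨0, 8, 0, 121, 0⟩ : WeierstrassCurve ℚ).twoIsogenyTorsorHom.range) = 4 := by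
  haveI hE' : (⟨0, ((8 : ℤ) : ℚ), 0, ((121 : ℤ) : ℚ), 0⟩ : WeierstrassCurve ℚ).IsElliptic := by
    rw [lit_X]; exact hE
  have key := two_pow_twoIsogenySelmerRank'_eq_natCard_mul (a := 8) (b := 121) habX
  rw [twoIsogenySelmerRank'_X, lit_X', natCard_range_xSqClass_X'_eq.1,
    natCard_sha_inf_range_congr lit_X] at key
  omega

/-! ## 3. Consequences -/

/-- **`Ш(X/ℚ) ≠ 0`** for the rank-`1` curve `X = [0, 8, 0, 121, 0]`. [cite: SilvermanAEC2009, Prop. X.6.5(b) (the method)] -/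
theorem sha_X_ne_bot : (⟨0, 8, 0, 121, 0⟩ : WeierstrassCurve ℚ).sha ≠ ⊥ := by
  haveI := isElliptic_X
  intro h
  have h4 := natCard_sha_inf_range_eq
  rw [h, bot_inf_eq, AddSubgroup.card_bot] at h4
  norm_num at h4

/-- **`Ш(X/ℚ)[2] ≠ 0`**: a non-zero class of order `2` in `Ш(X/ℚ)`. [cite: SilvermanAEC2009, Prop. X.6.5(b) (the method) with Thm. X.4.2(a)] -/
theorem exists_mem_sha_X_ne_zero_two_smul :
    ∃ c ∈ (⟨0, 8, 0, 121, 0⟩ : WeierstrassCurve ℚ).sha, c ≠ 0 ∧ 2 • c = 0 := by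
  haveI := isElliptic_X
  set G := (⟨0, 8, 0, 121, 0⟩ : WeierstrassCurve ℚ).sha ⊓
    (⟨0, 8, 0, 121, 0⟩ : WeierstrassCurve ℚ).twoIsogenyTorsorHom.range with hG
  have h4 : Nat.card ↥G = 4 := natCard_sha_inf_range_eq
  haveI : Finite ↥G := Nat.finite_of_card_ne_zero (by rw [h4]; norm_num)
  have hnt : Nontrivial ↥G := Finite.one_lt_card_iff_nontrivial.mp (by rw [h4]; norm_num)
  obtain ⟨⟨c, hc⟩, hne⟩ := exists_ne (0 : ↥G)
  have hc' := hc
  rw [hG, AddSubgroup.mem_inf] at hc'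
  obtain ⟨hsha, ⟨x, hx⟩⟩ := hc'
  refine ⟨c, hsha, fun h0 => hne (Subtype.ext h0), ?_⟩
  rw [← hx]
  exact two_nsmul_twoIsogenyTorsorHom _ x

/-- **The first descent at `2` does not decide `X`**: `Ш(X/ℚ)[2] = 0` FAILS. [cite: SilvermanAEC2009, Prop. X.6.5(b) (the method)] -/
theorem not_forall_mem_sha_X_two_smul_eq_zero :
    ¬ ∀ c ∈ (⟨0, 8, 0, 121, 0⟩ : WeierstrassCurve ℚ).sha, 2 • c = 0 → c = 0 := by
  intro h
  obtain ⟨c, hc, hne, h2⟩ := exists_mem_sha_X_ne_zero_two_smul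
  exact hne (h c hc h2)

/-- **`Ш(X/ℚ)[2^∞] ≠ 0`.** [cite: SilvermanAEC2009, Prop. X.6.5(b) (the method)] -/
theorem primaryComponent_sha_X_two_ne_bot :
    AddCommGroup.primaryComponent (⟨0, 8, 0, 121, 0⟩ : WeierstrassCurve ℚ).sha 2 ≠ ⊥ := by
  obtain ⟨c, hc, hne, h2⟩ := exists_mem_sha_X_ne_zero_two_smul
  intro h
  have hmem : (⟨c, hc⟩ : ↥(⟨0, 8, 0, 121, 0⟩ : WeierstrassCurve ℚ).sha) ∈
      AddCommGroup.primaryComponent (⟨0, 8, 0, 121, 0⟩ : WeierstrassCurve ℚ).sha 2 := by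
    refine ⟨1, ?_⟩
    simp only [pow_one]
    exact Subtype.ext (by simpa using h2)
  rw [h, AddSubgroup.mem_bot] at hmem
  exact hne (congrArg Subtype.val hmem)

/-- **A finite non-trivial `Ш[2^∞]` at rank `1`**: `Ш(X/ℚ)[2^∞]` is finite (`t_2(X) = 0`) and non-zero, `rank X(ℚ) = 1`.
[cite: SilvermanAEC2009, Prop. X.6.5(b) (the method)] [cite: Greenberg1999LNM, §1 pp. 54–57] -/
theorem finite_and_ne_bot_primaryComponent_sha_X_two :
    Finite (AddCommGroup.primaryComponent (⟨0, 8, 0, 121, 0⟩ : WeierstrassCurve ℚ).sha 2) ∧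
      AddCommGroup.primaryComponent (⟨0, 8, 0, 121, 0⟩ : WeierstrassCurve ℚ).sha 2 ≠ ⊥ ∧
      (⟨0, 8, 0, 121, 0⟩ : WeierstrassCurve ℚ).mordellWeilRank = 1 :=
  ⟨finite_primaryComponent_sha_X_two, primaryComponent_sha_X_two_ne_bot, mordellWeilRank_X⟩

/-- **`Ш[2]` is not an isogeny invariant at rank `1` either**: `X ~ Y`, `Ш(Y/ℚ)[2] = 0`, `Ш(X/ℚ)[2] ≠ 0`, `t_2(X) = t_2(Y) = 0`.
[cite: SilvermanAEC2009, Prop. X.6.5(b) (the method)] [cite: Greenberg1999LNM, §1 pp. 54–57] -/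
theorem sha_two_torsion_not_isogeny_invariant :
    IsIsogenous (⟨0, 8, 0, 121, 0⟩ : WeierstrassCurve ℚ) (⟨0, -58, 0, 616, 0⟩ : WeierstrassCurve ℚ) ∧
      (∀ c ∈ (⟨0, -58, 0, 616, 0⟩ : WeierstrassCurve ℚ).sha, 2 • c = 0 → c = 0) ∧
      (¬ ∀ c ∈ (⟨0, 8, 0, 121, 0⟩ : WeierstrassCurve ℚ).sha, 2 • c = 0 → c = 0) ∧
      (⟨0, 8, 0, 121, 0⟩ : WeierstrassCurve ℚ).shaCorank 2 = 0 ∧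
      (⟨0, -58, 0, 616, 0⟩ : WeierstrassCurve ℚ).shaCorank 2 = 0 :=
  ⟨isIsogenous_X_Y, forall_mem_sha_Y_two_smul_eq_zero, not_forall_mem_sha_X_two_smul_eq_zero,
    shaCorank_X_two, shaCorank_Y_two⟩

/-- **`corank_{ℤ₂} Sel_{2^∞}(X/ℚ) = 1 = rank X(ℚ)`** although `Ш(X/ℚ)[2] ≠ 0` (Greenberg's identity `corank Sel_{p^∞} = rank + t_p`).
[cite: Greenberg1999LNM, §1 pp. 54–57] -/
theorem selmerCorank_X_two : (⟨0, 8, 0, 121, 0⟩ : WeierstrassCurve ℚ).selmerCorank 2 = 1 := by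
  haveI := isElliptic_X
  haveI : Fact (Nat.Prime 2) := ⟨Nat.prime_two⟩
  rw [WeierstrassCurve.selmerCorank_eq_mordellWeilRank_add_holds, mordellWeilRank_X, shaCorank_X_two]


end Curve8x121

end Literature.NumberTheory.EllipticCurves

end
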